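import Summits.AtomisticToContinuum.Crystallization.Theorems.ChargedEnergyGap.Negative.PeriodicForm
import Summits.AtomisticToContinuum.Crystallization.Theorems.PricedLinkCensusTruncatedCensusGapChargeFreeOpenAtBarlow
import Literature.MathematicalPhysics.StatisticalMechanics.BarlowStacking

/-!
# Exact Barlow stackings in the spacing window are charge-free as periodic configurations

Stub `motifCharged_barlowPeriodicConfiguration_eq_zero` of the line `sharp-m-potential-compactness`
for the crux `PricedLinkCensus.TruncatedCensusGap` (item stmt-AtomisticToContinuum-14230).  The
final statement is the registered signature VERBATIM (self-contained over tree declarations).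

By the landed periodic form of the crux (`truncatedCensusGap_iff_periodicPricing`) the crux says
that every periodic configuration pays `κ` per CHARGED motif site, charge being read in the
infinite point set (scale-free bond graph at tolerance `1/100`: twelve bonds, all ring numbers
four).  The zero set of the line is the family of exact Barlow stackings `barlowStacking a h s`
(triangular layers of spacing `a`, any Hägg sequence `s`, layer spacing `h` in the window
`[0.812a, 0.821a]`, which contains the `V_χ`-relaxed hcp).  Here we certify that this family is
charge-free AS PERIODIC CONFIGURATIONS (`motifCharged (1/100) Q = 0` for
`Q = barlowPeriodicConfiguration s …`, `s` `p`-periodic), so the periodic pricing imposes on it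
nothing beyond `e* ≤ e(Q)`.

## Proof

`isChargeFree_barlowStacking_window`: every point `x` of `T = barlowStacking a h s` is
charge-free in the configuration `Subtype.val : T → ℝ³`, by the landed abstract lemma
`isChargeFree_of_wideGermMatched` (file `…ChargeFreeOpenAtBarlow`) with the IDENTITY matching
(`hM1`: the site itself, distance `0`; `hM2`: the point itself as a site, distance `0`), the
separation `min a h ≥ 0.812a ≥ a/2` (`le_dist_of_mem_barlowStacking`), and the window-link facts
`hT1`–`hT4` of `T` exactly as in the landed `stub_chargeFreeOpenAtBarlow`
(`wgerm_window_bounds`, `stub_barlowWindowLink`, `le_dist_of_mem_barlowStacking`).  Then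
`(barlowPeriodicConfiguration s …).points = barlowStacking a h s`
(`barlowPeriodicConfiguration_points`) and the subtype of charged motif sites is empty.
-/

noncomputable section

namespace Summit.AtomisticToContinuum.Crystallization.Theorems.PricedLinkCensusTruncatedCensusGap

open Literature.MathematicalPhysics.StatisticalMechanics Literature.Geometry.DiscreteGeometry
open Summit.AtomisticToContinuum.Crystallization.Theorems.ChargedEnergyGapNegative

/-- **Every point of a Barlow stacking in the spacing window is charge-free** in the configuration
indexed by the stacking itself (`Subtype.val`): `s` Hägg, `0 < a`, `0.812a ≤ h ≤ 0.821a`, tolerance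
`1/100`.  Stated for any set `S` equal to the stacking, so that it applies verbatim to the point
set of the periodic configuration. [folklore] -/
theorem isChargeFree_barlowStacking_window {a h : ℝ} {s : ℤ → ℤ} (ha : 0 < a)
    (hh1 : 812 / 1000 * a ≤ h) (hh2 : h ≤ 821 / 1000 * a) (hs : IsHaggSeq s)
    {S : Set (EuclideanSpace ℝ (Fin 3))} (hS : S = barlowStacking a h s) (x : S) :
    IsChargeFree (1 / 100 : ℝ) (Subtype.val : S → EuclideanSpace ℝ (Fin 3)) x := by
  subst hS
  obtain ⟨hl1, hl2⟩ := wgerm_window_bounds ha hh1 hh2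
  have hW' := stub_barlowWindowLink a h s ha (by linarith) (by linarith) hs
  refine isChargeFree_of_wideGermMatched (T := barlowStacking a h s) ha ?_ ?_
    (fun z₀ hz₀ => (hW' z₀ hz₀).2.1) (fun z₀ hz₀ => (hW' z₀ hz₀).2.2) ?_ ?_ ?_
  · -- `hT1`: the stacking is `min a h ≥ 0.812a ≥ 0.81a`-separated
    intro z hz w hw hne
    have h1 := le_dist_of_mem_barlowStacking a h s ha.le (by linarith) hz hw hne
    have h2 : 81 / 100 * a ≤ min a h := le_min (by linarith) (by linarith)
    linarith
  · -- `hT2`: near distances are `a` or `√(a²/3 + h²) ∈ [0.9963a, 1.0037a]`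
    intro z₀ hz₀ z hz hne hd
    rcases (hW' z₀ hz₀).1 z hz hne hd with h' | h' <;> rw [h']
    · constructor <;> linarith
    · exact ⟨hl1, hl2⟩
  · -- `hsep`: the sites are the points, `min a h ≥ a/2`-separated
    intro j k hjk _
    have h1 := le_dist_of_mem_barlowStacking a h s ha.le (by linarith) j.2 k.2
      fun heq => hjk (Subtype.ext heq)
    have h2 : a / 2 ≤ min a h := le_min (by linarith) (by linarith)
    linarith
  · -- `hM1`: every site is a point (identity matching)
    intro j _
    exact ⟨j.1, j.2, by rw [dist_self]; positivity⟩
  · -- `hM2`: every point is a site (identity matching)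
    intro z hz _
    exact ⟨⟨z, hz⟩, by rw [dist_self]; positivity⟩

/-- **Exact Barlow stackings in the spacing window are charge-free as periodic configurations.**
For `a ≠ 0`, `h ≠ 0`, `p ≠ 0`, a `p`-periodic Hägg sequence `s`, `0 < a` and
`0.812a ≤ h ≤ 0.821a`, the periodic configuration `barlowPeriodicConfiguration s ha hh hp hs`
(point set `barlowStacking a h s`) has NO charged motif site at tolerance `1/100`:
`motifCharged (1/100) Q = 0`.  Registered signature, verbatim. [folklore] -/
theorem motifCharged_barlowPeriodicConfiguration_eq_zero : ∀ (a h : ℝ) (p : ℕ) (s : ℤ → ℤ) (ha : a ≠ 0) (hh : h ≠ 0) (hp : p ≠ 0) (hs : ∀ i : ℤ, s (i + p) = s i), 0 < a → 812 / 1000 * a ≤ h → h ≤ 821 / 1000 * a → IsHaggSeq s → Summit.AtomisticToContinuum.Crystallization.Theorems.ChargedEnergyGapNegative.motifCharged (1 / 100) (barlowPeriodicConfiguration s ha hh hp hs) = 0 := by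
  intro a h p s ha hh hp hs ha0 hh1 hh2 hHagg
  unfold motifCharged
  haveI : IsEmpty {x : (barlowPeriodicConfiguration s ha hh hp hs).motif //
      ¬ IsChargeFree (1 / 100 : ℝ)
        (Subtype.val : (barlowPeriodicConfiguration s ha hh hp hs).points → E3)
        ⟨x.1, (barlowPeriodicConfiguration s ha hh hp hs).mem_points_of_mem_motif x.2⟩} :=
    ⟨fun x => x.2 (isChargeFree_barlowStacking_window ha0 hh1 hh2 hHagg
      (barlowPeriodicConfiguration_points s ha hh hp hs) _)⟩
  exact Nat.card_of_isEmpty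

end Summit.AtomisticToContinuum.Crystallization.Theorems.PricedLinkCensusTruncatedCensusGap

end
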